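import Summits.BirchSwinnertonDyer.BirchSwinnertonDyer.Theorems.SignedLowerHalvesSprungLowerDivisibilityAtThreeTypedInputsInconsistent
import Summits.BirchSwinnertonDyer.BirchSwinnertonDyer.Theorems.SignedLowerHalvesSprungLowerDivisibilityAtThreeChromaticPerPair
import Summits.BirchSwinnertonDyer.BirchSwinnertonDyer.Theorems.SignedLowerHalvesSprungLowerDivisibilityAtThreeStubPeriodMu
import HarnessLib

/-!
# Crux `SprungLowerDivisibilityAtThree` (K1, item stmt-BirchSwinnertonDyer-19875), line `chromatic-common-zeros`:
# THE TYPED INPUT PACK IS INCONSISTENT MODULO ONE **COPRIME** CELL WHOSE `L♭` HAS A ZERO — sequel of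
# `…TypedInputsInconsistent` (p666272) with the x8 ledger's STANDARD chromatic datum in place of the dear ι-self datum

LEAD seat `cruxlead-stmt-BirchSwinnertonDyer-19875` gen 6 (prover; D-0154 KEY (147)(a)/(148)(a) row 8; host `pub/bsd-ssimc`),
2026-08-28. `--supports` 19875 `--as helper`; THEOREMS ONLY; route-independent imports. Closes NOTHING, refutes NOTHING.
**BSD is NOT proved; K1 is neither proved nor Lean-refuted; no X8 cell moves.**

## What

x8 lit T59 (e)/(S1)–(S5): the (R12) datum of the prequel (`μ = 0`, `λ = 2`, `L^∘(0) ≠ 0`, `L^∘(T^ι) ∉ (L^∘)`) is equivalent to the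
chromatic (R10′) datum but ≈1½ `3`-adic digits DEARER to certify (272/273 `λ = 2` colour-instances undecided at the `n ≤ 6` tables:
the pair functional equation `η·L♭^ι = 3T·u·L♯ + M₁₁·L♭` makes a colour and its `ι`-conjugate digit-close). The datum the x8 per-pair
ledger is actually built on is (R0)'s `hnc` — «at every height-one prime some Néron-normalised colour lies outside it», i.e. NO COMMON
ZERO of `(L♯, L♭)` (x8 R5 verdicts: ≈171/217 cells `coprime`; referee ledger 188/217 prospective). With it: if `L♭` has `μ = 0`,
`λ ≥ 1` and `L♭(0) ≠ 0`, an irreducible `π ∣ L♭` generates a height-one `𝔭 ∌ 3, T` (UFD / Krull); `hnc` at `𝔭` exhibits a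
colour outside `𝔭`, necessarily `♯` (`G′ = C(u)·L^{•′}` with `u ∈ ℤ_pˣ` by `ChromaticCommonZeros.norm_periodRatio_eq_one_of_classX8`),
so `𝔭` is a PRIVATE zero of `L♭`; by the tree's X8 functional equation (`ChromaticIota.ClassX8.sharp_mem_of_flat_mem_of_subst_flat_mem`;
T59 (S1): «ι-paired zeros of `L♭` = common zeros») it is `ι`-UNPAIRED; the prequel's §1
`not_sprungSharpFlatLowerDivisibility_of_printedKato_of_unpairedZero` refutes the typed leaf at `♭` modulo {Thm. 7.14, Thm. 7.16 in
print keying, period}, while (R0) `ChromaticCommonZeros.sprungSharpFlatLowerDivisibility_of_noCommonZero` (`…ChromaticPerPair`) PROVES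
it modulo {Thm. 7.14, period, `hJ` γ-keyed}. HENCE `false_of_typedInputsX8_of_coprimeCell_flatZero`:

  `thm714 → period → hJ (γ-keyed) → thm716_contra (print-keyed) → exists_isNewformOf → (ONE X8 pair with hnc ∧ «L♭: μ = 0, λ ≥ 1, L♭(0) ≠ 0») → False`,

certificate class = every COPRIME rank-0 cell with `λ(L♭) ≥ 1` (typical `λ♭ = 2`) — the kernel form of the (267) COHERENCE
WARNING now sits on the census's commonest certified datum. Reading corollary: `¬ hJ` modulo print + such a cell. Nothing here says
which fact nature falsifies (R-228 / T67: `hJ` as typed).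

References: Sprung, JNT 132 (2012) Def. 6.1, Thm. 7.14 with (3), Thm. 7.16, Main Conj. 7.21 [Sprung2012]; Sprung, ANT 11 (2017)
Thm. 1.12, Thm. 4.13 / Cor. 4.14 [Sprung2017]; Washington, GTM 83 §7.1, §13.2 [Washington1997]; Greenberg–Vatsal 2000 Rem. 3.4
[GreenbergVatsal2000]; Diamond–Shurman Thm. 8.8.3 [DiamondShurman2005].
-/

set_option autoImplicit false
-- the problem directory `BirchSwinnertonDyer/BirchSwinnertonDyer` forces the duplicated namespace segment
set_option linter.dupNamespace false

noncomputable section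

open scoped Classical NumberField MatrixGroups ModularForm

open NumberField IsDedekindDomain CongruenceSubgroup WeierstrassCurve PowerSeries
  Literature.NumberTheory.EllipticCurves Literature.NumberTheory.EllipticCurves.ModularForms
  Literature.NumberTheory.EllipticCurves.ZpExtension Literature.NumberTheory.EllipticCurves.Sprung2017
  Literature.NumberTheory.EllipticCurves.Sprung2012 Literature.NumberTheory.EllipticCurves.Rank1Residual
  Literature.NumberTheory.EllipticCurves.IwasawaAlgebra Literature.Barriers.BirchSwinnertonDyer
  Summit.BirchSwinnertonDyer.Rank1Residual.X1.MuLambda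

namespace Summit.BirchSwinnertonDyer.BirchSwinnertonDyer.Theorems

namespace ChromaticKeying

/-! ## §1 Pure algebra: a height-one zero off `(p)` and `(T)` -/

section CoprimeCell

variable {p : ℕ} [hp : Fact p.Prime]

/-- **A `p`-free non-unit series with non-zero constant term has a height-one zero off `(p)` and `(T)`.** In `Λ = ℤ_p⟦T⟧`: `F ≠ 0`,
`μ(F) = 0`, `1 ≤ λ(F)`, `F(0) ≠ 0` ⟹ ∃ height-one `𝔭` with `p ∉ 𝔭`, `T ∉ 𝔭`, `F ∈ 𝔭` (an irreducible factor `π` of the non-unit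
`F`; `(π)` has height one; `π ≁ p` by `μ(F) = 0`, `π ≁ T` by `F(0) ≠ 0`). [cite: Washington1997, §7.1 (Thm. 7.3) and §13.2] -/
theorem exists_heightOne_zero_of_mu_eq_zero_of_one_le_lam {F : IwasawaAlgebra p} (hF0 : F ≠ 0) (hμF : mu F = 0)
    (hlamF : 1 ≤ lam F) (hcF : PowerSeries.constantCoeff F ≠ 0) :
    ∃ 𝔭 : PrimeSpectrum (IwasawaAlgebra p), 𝔭.asIdeal.height = 1 ∧ (p : IwasawaAlgebra p) ∉ 𝔭.asIdeal ∧
      (PowerSeries.X : IwasawaAlgebra p) ∉ 𝔭.asIdeal ∧ F ∈ 𝔭.asIdeal := by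
  have hFnu : ¬ IsUnit F := by
    intro hu
    have h := ((isUnit_iff_mu_eq_zero_and_lam_eq_zero F).1 hu).2.2
    rw [h] at hlamF
    exact Nat.not_succ_le_zero 0 hlamF
  obtain ⟨π, hπirr, hπF⟩ := WfDvdMonoid.exists_irreducible_factor hFnu hF0
  have hπ : Prime π := hπirr.prime
  haveI hprime : (Ideal.span {π}).IsPrime := (Ideal.span_singleton_prime hπ.ne_zero).mpr hπ
  let 𝔭 : PrimeSpectrum (IwasawaAlgebra p) := ⟨Ideal.span {π}, hprime⟩
  have h1 : 𝔭.asIdeal.height = 1 := Module.height_span_singleton_eq_one_of_prime hπ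
  refine ⟨𝔭, h1, ?_, ?_, Ideal.mem_span_singleton.mpr hπF⟩
  · -- `p ∉ 𝔭`: otherwise `π ~ p ∣ F`, `μ(F) ≥ 1`
    intro hp𝔭
    have hπp : π ∣ (p : IwasawaAlgebra p) := Ideal.mem_span_singleton.mp hp𝔭
    have hassoc : Associated π (p : IwasawaAlgebra p) :=
      hπirr.associated_of_dvd IwasawaAlgebra.prime_natCast.irreducible hπp
    have hC : PowerSeries.C ((p : ℤ_[p]) ^ 1) ∣ F := by
      rw [pow_one, map_natCast]; exact hassoc.symm.dvd.trans hπF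
    have h1le : 1 ≤ mu F := le_mu_of_C_pow_dvd hF0 hC
    rw [hμF] at h1le
    exact Nat.not_succ_le_zero 0 h1le
  · -- `T ∉ 𝔭`: otherwise `π ~ T ∣ F`, `F(0) = 0`
    intro hT𝔭
    have hπT : π ∣ (PowerSeries.X : IwasawaAlgebra p) := Ideal.mem_span_singleton.mp hT𝔭
    have hassoc : Associated π (PowerSeries.X : IwasawaAlgebra p) :=
      hπirr.associated_of_dvd PowerSeries.X_prime.irreducible hπT
    exact hcF (PowerSeries.X_dvd_iff.mp (hassoc.symm.dvd.trans hπF))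

end CoprimeCell

/-! ## §2 The coprime cell refutes the typed leaf at `♭`; the typed input pack is inconsistent there -/

section CoprimeInconsistency

variable (W : WeierstrassCurve ℚ) [W.IsElliptic] [W.IsGloballyMinimal] (p : ℕ) [Fact p.Prime]

/-- **PER-PAIR: a COPRIME pair whose `L♭` has a zero refutes the typed leaf at `♭`** (modulo Sprung Thm. 7.14, Thm. 7.16 in
print keying and the period unit, by name). On an X8 pair with newform `f`, a RATIONAL period ratio `ϖ` (`ϖ·Ω_E = Ω_f⁺`), a Sprung
pair, (R0)'s datum at this instance — «at every height-one `𝔭` some normalised colour `G′` (`ι G′ = C(ϖ)·ι L^{•′}`) lies outside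
`𝔭`» — and `μ(L♭) = 0`, `1 ≤ λ(L♭)`, `L♭(0) ≠ 0`: `¬ SprungSharpFlatLowerDivisibility W p ♭`. The zero of `L♭` off `(3), (T)`
(`exists_heightOne_zero_of_mu_eq_zero_of_one_le_lam`) is PRIVATE by the datum (a normalised colour outside `𝔭` is `♯`, since
`G′ = C(u)·L^{•′}` with `u ∈ ℤ_pˣ` by `ChromaticCommonZeros.norm_periodRatio_eq_one_of_classX8`), hence `ι`-unpaired by the X8
functional equation (`ChromaticIota.ClassX8.sharp_mem_of_flat_mem_of_subst_flat_mem`), and §1 applies. [cite: Sprung2017, Thm.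
4.13 and Cor. 4.14] [cite: Sprung2012, Thm. 7.14 and Thm. 7.16 (p. 1504), Main Conj. 7.21 (p. 1505)] [cite: GreenbergVatsal2000, Rem. 3.4] -/
theorem not_sprungSharpFlatLowerDivisibility_flat_of_printedKato_of_coprime_of_flatZero
    (h714 : thm714_sharpFlatSelmerDual_finite_torsion) (h716c : thm716_sharpFlatCharIdeal_divisibility_contra)
    (hper : realPeriodRat_eq_unit_mul_plusPeriod_three) (hX : ClassX8 W p)
    {N : ℕ} [NeZero N] (f : CuspForm (Gamma0 N) 2) (hf : IsNewformOf W f)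
    (ϖ : ℚ) (hϖ : (ϖ : ℝ) * W.realPeriodRat = plusPeriod f) (Lsharp Lflat : IwasawaAlgebra p)
    (hSP : IsSprungPair f p (W.frobeniusTrace p) Lsharp Lflat)
    (hnc : ∀ 𝔭 : PrimeSpectrum (IwasawaAlgebra p), 𝔭.asIdeal.height = 1 →
      ∃ (col' : Chroma) (G' : IwasawaAlgebra p),
        iwasawaToPowerSeries p G' = PowerSeries.C (ϖ : ℚ_[p]) * iwasawaToPowerSeries p (chromaticL col' Lsharp Lflat) ∧
        G' ∉ 𝔭.asIdeal)
    (hμ : mu Lflat = 0) (hlam : 1 ≤ lam Lflat) (hc0 : PowerSeries.constantCoeff Lflat ≠ 0) :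
    ¬ SprungSharpFlatLowerDivisibility W p Chroma.flat := by
  have hF0 : Lflat ≠ 0 := fun h => hc0 (by rw [h, map_zero])
  obtain ⟨𝔭, h1, hp𝔭, hT𝔭, hLf⟩ := exists_heightOne_zero_of_mu_eq_zero_of_one_le_lam hF0 hμ hlam hc0
  -- the datum at `𝔭`: a normalised colour outside `𝔭`; it is `♯`, so `L♯ ∉ 𝔭`
  obtain ⟨col', G', hG', hG'𝔭⟩ := hnc 𝔭 h1
  have hnorm : ‖(ϖ : ℚ_[p])‖ = 1 := ChromaticCommonZeros.norm_periodRatio_eq_one_of_classX8 hper W p hX f hf ϖ hϖ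
  set w : ℤ_[p] := ⟨(ϖ : ℚ_[p]), hnorm.le⟩ with hw_def
  have hcoe : (w : ℚ_[p]) = (ϖ : ℚ_[p]) := rfl
  have hGeq : G' = PowerSeries.C w * chromaticL col' Lsharp Lflat :=
    iwasawaToPowerSeries_injective p (by rw [hG', ChromaticCommonZeros.iwasawaToPowerSeries_C_mul, hcoe])
  have hLcol' : chromaticL col' Lsharp Lflat ∉ 𝔭.asIdeal := by
    intro hmem
    exact hG'𝔭 (hGeq ▸ Ideal.mul_mem_left _ _ hmem)
  have hLs : Lsharp ∉ 𝔭.asIdeal := by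
    cases col' with
    | sharp => rwa [chromaticL_sharp] at hLcol'
    | flat => exact absurd (by rwa [chromaticL_flat] at hLcol' : Lflat ∉ 𝔭.asIdeal) (not_not_intro hLf)
  -- a private zero of `L♭` off `(p), (T)` is `ι`-unpaired (X8 functional equation); §1 at colour `♭`
  refine not_sprungSharpFlatLowerDivisibility_of_printedKato_of_unpairedZero W p h714 h716c hper hX f Lsharp Lflat hf hSP
    Chroma.flat 𝔭 hp𝔭 (by rw [chromaticL_flat]; exact hLf) ?_
  rw [chromaticL_flat, invol_eq_subst]
  intro hι
  exact hLs (ChromaticIota.ClassX8.sharp_mem_of_flat_mem_of_subst_flat_mem W p hX f hf Lsharp Lflat hSP 𝔭.asIdeal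
    𝔭.isPrime hp𝔭 hT𝔭 hLf hι)

/-- **THE TYPED INPUT PACK IS INCONSISTENT MODULO ONE COPRIME CELL WHOSE `L♭` HAS A ZERO.** Sprung 2012 Thm. 7.14 (`h714`), the
period unit at `3` (`h3`), the γ-KEYED joint package fact `hJ = thm714seq_sharpFlatColemanKato_zetaJoint`, Thm. 7.16 IN PRINT KEYING
(`h716c`), modularity (`hmod`) — BY NAME — and ONE X8 pair carrying (R0)'s datum `hnc` VERBATIM (no common zero of the normalised
colours, for every newform/period-ratio/Sprung-pair instance) together with «`μ(L♭) = 0`, `1 ≤ λ(L♭)`, `L♭(0) ≠ 0`» for every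
instance, prove `False`: (R0) `sprungSharpFlatLowerDivisibility_of_noCommonZero` gives the typed leaf at `♭` from `h714 ∧ h3 ∧ hJ`,
the previous theorem refutes it from `h714 ∧ h716c ∧ h3` (the instance exists: `hmod`, `thm112_exists_isSprungPair_holds`, and
`ϖ := u⁻¹` from the period fact). Certificate class = the x8 ledger's own: every `coprime` rank-0 cell with `λ(L♭) ≥ 1` (R5: 171
coprime verdicts; typical `λ♭ = 2`). Says nothing about which fact nature falsifies (R-228/T67: `hJ` as typed); proves nothing about
BSD / K1 / K_spor; refutes no item. [cite: Sprung2012, Def. 6.1 (p. 1495), Thm. 7.14 with (3) and Thm. 7.16 (p. 1504), Main Conj.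
7.21 (p. 1505)] [cite: Sprung2017, Thm. 1.12, Thm. 4.13 and Cor. 4.14] [cite: DiamondShurman2005, Thm. 8.8.3] [cite: GreenbergVatsal2000, Rem. 3.4] -/
theorem false_of_typedInputsX8_of_coprimeCell_flatZero
    (h714 : thm714_sharpFlatSelmerDual_finite_torsion) (h3 : realPeriodRat_eq_unit_mul_plusPeriod_three)
    (hJ : thm714seq_sharpFlatColemanKato_zetaJoint) (h716c : thm716_sharpFlatCharIdeal_divisibility_contra)
    (hmod : exists_isNewformOf) (hX : ClassX8 W p)
    (hnc : ∀ {N : ℕ} [NeZero N] (f : CuspForm (Gamma0 N) 2) (ϖ : ℚ) (Lsharp Lflat : IwasawaAlgebra p),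
      IsNewformOf W f → (ϖ : ℝ) * W.realPeriodRat = plusPeriod f →
      IsSprungPair f p (W.frobeniusTrace p) Lsharp Lflat →
      ∀ 𝔭 : PrimeSpectrum (IwasawaAlgebra p), 𝔭.asIdeal.height = 1 →
        ∃ (col' : Chroma) (G' : IwasawaAlgebra p),
          iwasawaToPowerSeries p G' =
            PowerSeries.C (ϖ : ℚ_[p]) * iwasawaToPowerSeries p (chromaticL col' Lsharp Lflat) ∧
          G' ∉ 𝔭.asIdeal)
    (hflat : ∀ {N : ℕ} [NeZero N] (f : CuspForm (Gamma0 N) 2), IsNewformOf W f →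
      ∀ Lsharp Lflat : IwasawaAlgebra p, IsSprungPair f p (W.frobeniusTrace p) Lsharp Lflat →
        mu Lflat = 0 ∧ 1 ≤ lam Lflat ∧ PowerSeries.constantCoeff Lflat ≠ 0) :
    False := by
  have hp2 : p ≠ 2 := by rw [hX.p_eq]; decide
  have hgood : W.HasGoodReductionAtPrime p :=
    Summit.BirchSwinnertonDyer.Rank1Residual.Supersingular.ClassX8.good W p hX
  have hss : (p : ℤ) ∣ W.frobeniusTrace p :=
    Summit.BirchSwinnertonDyer.Rank1Residual.Supersingular.ClassX8.dvd_frobeniusTrace W p hX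
  have hgood3 : W.HasGoodReductionAtPrime 3 := hX.2.1.1
  have hirr3 : W.HasIrreducibleModPGaloisRep 3 := ClassX8.irr W p hX
  -- the instance: newform, period ratio, Sprung pair
  haveI : NeZero (W.conductorNorm ℤ) := ⟨(W.conductorNorm_pos_holds).ne'⟩
  obtain ⟨f, hf⟩ := hmod W
  obtain ⟨u, hu1, hΩ⟩ := h3 W hgood3 hirr3 f hf
  have hu0 : u ≠ 0 := by
    intro h0
    rw [h0, Rat.cast_zero, norm_zero] at hu1
    exact zero_ne_one hu1
  have hϖ : ((u⁻¹ : ℚ) : ℝ) * W.realPeriodRat = plusPeriod f := by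
    rw [hΩ, Rat.cast_inv, ← mul_assoc, inv_mul_cancel₀ (Rat.cast_ne_zero.mpr hu0), one_mul]
  obtain ⟨Lsharp, Lflat, hSP⟩ := thm112_exists_isSprungPair_holds (W := W) (f := f) (p := p) hp2 hf hgood hss
  obtain ⟨hμ, hlam, hc0⟩ := hflat f hf Lsharp Lflat hSP
  have hyes : SprungSharpFlatLowerDivisibility W p Chroma.flat :=
    ChromaticCommonZeros.sprungSharpFlatLowerDivisibility_of_noCommonZero W p h714 h3 hJ hX hnc Chroma.flat
  exact not_sprungSharpFlatLowerDivisibility_flat_of_printedKato_of_coprime_of_flatZero W p h714 h716c h3 hX f hf u⁻¹ hϖ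
    Lsharp Lflat hSP (hnc f u⁻¹ Lsharp Lflat hf hϖ hSP) hμ hlam hc0 hyes

/-- **Reading: `hJ` refuted modulo print + one coprime cell whose `L♭` has a zero.** [cite: Sprung2012, Def. 6.1 (p. 1495), Thm.
7.14 with (3) and Thm. 7.16 (p. 1504)] [cite: Sprung2017, Thm. 1.12, Thm. 4.13 and Cor. 4.14] -/
theorem not_thm714seq_sharpFlatColemanKato_zetaJoint_of_printedKato_of_coprimeCell_flatZero
    (h714 : thm714_sharpFlatSelmerDual_finite_torsion) (h3 : realPeriodRat_eq_unit_mul_plusPeriod_three)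
    (h716c : thm716_sharpFlatCharIdeal_divisibility_contra) (hmod : exists_isNewformOf) (hX : ClassX8 W p)
    (hnc : ∀ {N : ℕ} [NeZero N] (f : CuspForm (Gamma0 N) 2) (ϖ : ℚ) (Lsharp Lflat : IwasawaAlgebra p),
      IsNewformOf W f → (ϖ : ℝ) * W.realPeriodRat = plusPeriod f →
      IsSprungPair f p (W.frobeniusTrace p) Lsharp Lflat →
      ∀ 𝔭 : PrimeSpectrum (IwasawaAlgebra p), 𝔭.asIdeal.height = 1 →
        ∃ (col' : Chroma) (G' : IwasawaAlgebra p),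
          iwasawaToPowerSeries p G' =
            PowerSeries.C (ϖ : ℚ_[p]) * iwasawaToPowerSeries p (chromaticL col' Lsharp Lflat) ∧
          G' ∉ 𝔭.asIdeal)
    (hflat : ∀ {N : ℕ} [NeZero N] (f : CuspForm (Gamma0 N) 2), IsNewformOf W f →
      ∀ Lsharp Lflat : IwasawaAlgebra p, IsSprungPair f p (W.frobeniusTrace p) Lsharp Lflat →
        mu Lflat = 0 ∧ 1 ≤ lam Lflat ∧ PowerSeries.constantCoeff Lflat ≠ 0) :
    ¬ thm714seq_sharpFlatColemanKato_zetaJoint :=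
  fun hJ => false_of_typedInputsX8_of_coprimeCell_flatZero W p h714 h3 hJ h716c hmod hX hnc hflat

end CoprimeInconsistency

end ChromaticKeying

end Summit.BirchSwinnertonDyer.BirchSwinnertonDyer.Theorems

end
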